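import Literature.NumberTheory.Transcendental.KaehlerHodge
import Literature.NumberTheory.Transcendental.DolbeaultIntegrabilityProofs

/-!
# Kähler identities ⇒ `Δ_∂̄ = Δ_∂`: the algebraic step (Huybrechts Prop. 3.1.12, (ii) ⇒ (iii))

Trunk **T-KAEHLER** (`NumberTheory/Transcendental`), theorems-and-one-predicate companion of
`Literature/NumberTheory/Transcendental/KaehlerHodge.lean`, serving its named fact
`Literature.NumberTheory.Transcendental.dolbeaultLaplacian_eq_delLaplacian` (the Kähler identity
`Δ_∂̄ = Δ_∂`; Voisin (2002), Thm. 6.7; Huybrechts (2005), Prop. 3.1.12 (iii)).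

Both sources prove `Δ_∂ = Δ_∂̄` in two steps:

1. the **first-order Kähler identities** `[Λ, ∂̄] = -i∂*`, `[Λ, ∂] = i∂̄*` for the adjoint `Λ` of
   the Lefschetz operator `L = ω ∧ ·` (Voisin (2002), Prop. 6.5, eq. (6.3), p. 139, proved from the
   flat case, Lemma 6.6, through osculating holomorphic coordinates, Prop. 3.14; Huybrechts (2005),
   Prop. 3.1.12 (ii), pp. 120–122, proved through the Lefschetz decomposition of forms and Weil's
   formula, Prop. 1.2.31);
2. a **purely algebraic step**: substituting `∂* = i[Λ, ∂̄]`, `∂̄* = -i[Λ, ∂]` into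
   `Δ_∂ = ∂∂* + ∂*∂`, `Δ_∂̄ = ∂̄∂̄* + ∂̄*∂̄` and using only `∂∂̄ = -∂̄∂` and the additivity of `Λ`
   (Huybrechts (2005), proof of Prop. 3.1.12 (iii), p. 122: "`Δ_∂ = i[Λ,∂̄]∂ + i∂[Λ,∂̄] =
   i(Λ∂̄∂ - ∂̄Λ∂ + ∂Λ∂̄ - ∂∂̄Λ) = … = Δ_∂̄`"; Voisin (2002), proof of Thm. 6.7, p. 141).

Step 1 needs a theory absent from the tree (the pointwise Lefschetz/contraction operators on
`Λ^k T*M ⊗ ℂ`, osculating coordinates or the Lefschetz decomposition of forms) and is not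
attempted here. This file proves **step 2** once and for all, for an *arbitrary* family of
degree-lowering operators `Λ_j : Ω^{j+2}_ℂ(M) → Ω^j_ℂ(M)`:

* `Literature.NumberTheory.Transcendental.KaehlerIdentities o Λ` — the predicate (a `structure … : Prop`
  with the data `o`, `Λ` explicit; a hypothesis on `Λ`, not a named fact) recording that `Λ` is
  additive, preserves smoothness, and satisfies the `Λ`-form of the first-order Kähler identities
  `[Λ, ∂̄] = -i∂*`, `[Λ, ∂] = i∂̄*` on smooth forms (in degrees `≥ 2`, and in degree `1` where the
  term `∂̄Λα` is absent), for the metric of the ambient `RiemannianBundle` instance, the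
  orientation family `o` and the adjoints `∂* = -⋆∂̄⋆`, `∂̄* = -⋆∂⋆` of `KaehlerHodge.lean`;
* `Literature.NumberTheory.Transcendental.KaehlerIdentities.dolbeaultLaplacian_eq_delLaplacian` —
  on a complex manifold, `KaehlerIdentities o Λ` implies `Δ_∂̄ α = Δ_∂ α` for every smooth complex
  form `α`, in every degree (all four cases of the degree pattern-matching defining the Laplacians).

With the genuine contraction operator `Λ = ⋆⁻¹L⋆` of a Kähler metric and step 1, this closes the
Kähler identity `Δ_∂̄ = Δ_∂` (for complex manifolds; note that the named fact
`dolbeaultLaplacian_eq_delLaplacian` as elaborated does *not* carry the section's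
`[IsManifold 𝓘(ℂ, E) ω M]`, whereas every ingredient here — smoothness of type components,
`∂∂̄ = -∂̄∂` — requires the holomorphic atlas).

Also recorded: unconditional bookkeeping for `∂`, `∂̄` on smooth forms of a complex manifold
(`IsSmoothForm.dolbeault`, `dolbeault_neg`, `dolbeault_sub`, …, fed by the discharged facts of
`DolbeaultProofs.lean` / `DolbeaultIntegrabilityProofs.lean`) and the vanishing of complex forms of
degree `> dim_ℝ M`.

## References

* C. Voisin, *Hodge Theory and Complex Algebraic Geometry I* (2002), §6.1.1, Prop. 6.5 and
  Lemma 6.6 (pp. 139–140); §6.1.2, Thm. 6.7 (p. 141).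
* D. Huybrechts, *Complex Geometry. An Introduction* (2005), §3.1, Def. 3.1.3, Def. 3.1.5,
  Prop. 3.1.12 and its proof (pp. 114–122).
* P. Griffiths, J. Harris, *Principles of Algebraic Geometry* (1978), pp. 111–115.
-/

noncomputable section

open scoped Manifold ContDiff
open Bundle Module

namespace Literature.NumberTheory.Transcendental

open Literature.Geometry.Kaehler (MForm IsSmoothForm)

variable {E : Type*} [NormedAddCommGroup E] [NormedSpace ℂ E]
  {M : Type*} [TopologicalSpace M] [ChartedSpace E M] {k : ℕ}

/-! ### Bookkeeping for `∂` and `∂̄` -/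

section Unconditional

/-- `∂(-α) = -∂α` (no smoothness needed: `∂` commutes with complex scalars,
`dolbeault_smul_holds`). Voisin (2002), §2.3.1, Def. 2.27. [cite: Voisin2002, §2.3.1 Def. 2.27] -/
theorem dolbeault_neg (α : MForm 𝓘(ℝ, E) M ℂ k) : dolbeault (-α) = -dolbeault α := by
  rw [← neg_one_smul ℂ α, dolbeault_smul_holds (-1 : ℂ) α, neg_one_smul]

/-- `∂̄(-α) = -∂̄α` (no smoothness needed, `dolbeaultBar_smul_holds`). Voisin (2002), §2.3.1,
Def. 2.27. [cite: Voisin2002, §2.3.1 Def. 2.27] -/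
theorem dolbeaultBar_neg (α : MForm 𝓘(ℝ, E) M ℂ k) : dolbeaultBar (-α) = -dolbeaultBar α := by
  rw [← neg_one_smul ℂ α, dolbeaultBar_smul_holds (-1 : ℂ) α, neg_one_smul]

/-- The negative of a smooth form is smooth. [folklore] -/
theorem _root_.Literature.Geometry.Kaehler.IsSmoothForm.neg' {α : MForm 𝓘(ℝ, E) M ℂ k}
    (hα : IsSmoothForm α) : IsSmoothForm (-α) := by
  rw [← neg_one_smul ℂ α]
  exact hα.smul_complex (-1)

/-- The difference of two smooth forms is smooth. [folklore] -/
theorem _root_.Literature.Geometry.Kaehler.IsSmoothForm.sub' {α β : MForm 𝓘(ℝ, E) M ℂ k}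
    (hα : IsSmoothForm α) (hβ : IsSmoothForm β) : IsSmoothForm (α - β) := by
  rw [sub_eq_add_neg]
  exact hα.add hβ.neg'

/-- On a manifold modelled on `E` with `dim_ℝ E = n`, complex forms of degree `d > n` vanish
(`d` tangent vectors are linearly dependent and alternating maps kill dependent families;
Warner (1983), 2.6; cf. `Literature.Geometry.Kaehler.MForm.eq_zero_of_finrank_lt` for real
forms). [folklore] -/
theorem cform_eq_zero_of_finrank_lt [FiniteDimensional ℂ E] {n d : ℕ} [Fact (finrank ℝ E = n)]
    (hd : n < d) (α : MForm 𝓘(ℝ, E) M ℂ d) : α = 0 := by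
  funext x
  ext v
  have hV : finrank ℝ (TangentSpace 𝓘(ℝ, E) x) = n := Fact.out
  have hli : ¬ LinearIndependent ℝ v := by
    intro hli
    have := hli.fintype_card_le_finrank
    simp only [Fintype.card_fin, hV] at this
    omega
  simpa using (α x).toAlternatingMap.map_linearDependent v hli

end Unconditional

section Holomorphic

variable [IsManifold 𝓘(ℂ, E) ω M] [IsManifold 𝓘(ℝ, E) ∞ M]

/-- On a complex manifold, `∂α` is smooth for smooth `α` — `isSmoothForm_dolbeault` fed with the
discharged `isSmoothForm_typeComponent_holds` and the unconditional smoothness of `d`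
(`IsSmoothForm.mextDeriv`). Voisin (2002), §2.3.1. [cite: Voisin2002, §2.3.1] -/
theorem _root_.Literature.Geometry.Kaehler.IsSmoothForm.dolbeault {α : MForm 𝓘(ℝ, E) M ℂ k}
    (hα : IsSmoothForm α) : IsSmoothForm (dolbeault α) :=
  isSmoothForm_dolbeault isSmoothForm_typeComponent_holds (fun hβ ↦ hβ.mextDeriv) hα

/-- On a complex manifold, `∂̄α` is smooth for smooth `α` (`isSmoothForm_dolbeaultBar` fed with
`isSmoothForm_typeComponent_holds` and `IsSmoothForm.mextDeriv`). Voisin (2002), §2.3.1. [cite: Voisin2002, §2.3.1] -/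
theorem _root_.Literature.Geometry.Kaehler.IsSmoothForm.dolbeaultBar {α : MForm 𝓘(ℝ, E) M ℂ k}
    (hα : IsSmoothForm α) : IsSmoothForm (dolbeaultBar α) :=
  isSmoothForm_dolbeaultBar isSmoothForm_typeComponent_holds (fun hβ ↦ hβ.mextDeriv) hα

/-- `∂` is additive on smooth forms of a complex manifold (`dolbeault_add` fed with
`isSmoothForm_typeComponent_holds`). Voisin (2002), §2.3.1. [cite: Voisin2002, §2.3.1] -/
theorem dolbeault_add' {α β : MForm 𝓘(ℝ, E) M ℂ k} (hα : IsSmoothForm α) (hβ : IsSmoothForm β) :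
    dolbeault (α + β) = dolbeault α + dolbeault β :=
  dolbeault_add isSmoothForm_typeComponent_holds hα hβ

/-- `∂̄` is additive on smooth forms of a complex manifold (`dolbeaultBar_add` fed with
`isSmoothForm_typeComponent_holds`). Voisin (2002), §2.3.1. [cite: Voisin2002, §2.3.1] -/
theorem dolbeaultBar_add' {α β : MForm 𝓘(ℝ, E) M ℂ k} (hα : IsSmoothForm α)
    (hβ : IsSmoothForm β) : dolbeaultBar (α + β) = dolbeaultBar α + dolbeaultBar β :=
  dolbeaultBar_add isSmoothForm_typeComponent_holds hα hβ

/-- `∂(α - β) = ∂α - ∂β` for smooth forms of a complex manifold. Voisin (2002), §2.3.1. [cite: Voisin2002, §2.3.1] -/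
theorem dolbeault_sub {α β : MForm 𝓘(ℝ, E) M ℂ k} (hα : IsSmoothForm α) (hβ : IsSmoothForm β) :
    dolbeault (α - β) = dolbeault α - dolbeault β := by
  rw [sub_eq_add_neg, dolbeault_add' hα hβ.neg', dolbeault_neg, ← sub_eq_add_neg]

/-- `∂̄(α - β) = ∂̄α - ∂̄β` for smooth forms of a complex manifold. Voisin (2002), §2.3.1. [cite: Voisin2002, §2.3.1] -/
theorem dolbeaultBar_sub {α β : MForm 𝓘(ℝ, E) M ℂ k} (hα : IsSmoothForm α)
    (hβ : IsSmoothForm β) : dolbeaultBar (α - β) = dolbeaultBar α - dolbeaultBar β := by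
  rw [sub_eq_add_neg, dolbeaultBar_add' hα hβ.neg', dolbeaultBar_neg, ← sub_eq_add_neg]

/-- `∂∂̄α = -∂̄∂α` on smooth forms of a complex manifold (the discharged
`dolbeault_dolbeaultBar_add_dolbeaultBar_dolbeault_holds`, solved for `∂∂̄α`). Voisin (2002),
§2.3.1 (after Def. 2.27); Huybrechts (2005), Cor. 2.6.18. [cite: Voisin2002, §2.3.1 Def. 2.27] -/
theorem dolbeault_dolbeaultBar_eq_neg {α : MForm 𝓘(ℝ, E) M ℂ k} (hα : IsSmoothForm α) :
    dolbeault (dolbeaultBar α) = -dolbeaultBar (dolbeault α) :=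
  eq_neg_of_add_eq_zero_left (dolbeault_dolbeaultBar_add_dolbeaultBar_dolbeault_holds hα)

end Holomorphic

/-! ### The `Λ`-form of the first-order Kähler identities, as a hypothesis on `Λ` -/

section Identities

variable [FiniteDimensional ℂ E] {n : ℕ} [Fact (finrank ℝ E = n)]
  [RiemannianBundle (fun x : M ↦ TangentSpace 𝓘(ℝ, E) x)]
  (o : (x : M) → Orientation ℝ (TangentSpace 𝓘(ℝ, E) x) (Fin n))

/-- **The first-order Kähler identities for a contraction family `Λ`.** For a family of
degree-lowering operators `Λ_j : Ω^{j+2}_ℂ(M) → Ω^j_ℂ(M)` on the complex forms of `M` (with the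
metric of the ambient `RiemannianBundle` instance, the orientation family `o`, and the formal
adjoints `∂* = -⋆∂̄⋆ = dolbeaultAdjoint o`, `∂̄* = -⋆∂⋆ = dolbeaultBarAdjoint o` of
`KaehlerHodge.lean`), the predicate records:
* `Λ` is additive and maps smooth forms to smooth forms;
* `[Λ, ∂̄] = -i∂*` on smooth forms: `Λ(∂̄β) - ∂̄(Λβ) = -i ∂*β` in degrees `≥ 2`, and
  `Λ(∂̄β) = -i ∂*β` on `1`-forms (where `Λβ = 0`);
* `[Λ, ∂] = i∂̄*` on smooth forms, in the same two shapes.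
For the adjoint `Λ = ⋆⁻¹L⋆` of the Lefschetz operator `L = ω ∧ ·` of a Kähler metric these are
the Kähler identities of Voisin (2002), Prop. 6.5, eq. (6.3) (p. 139) = Huybrechts (2005),
Prop. 3.1.12 (ii), second half (`[Λ, ∂̄] = -i∂*`, `[Λ, ∂] = i∂̄*`); here they are a *hypothesis on
the data `Λ`* (a predicate with `o`, `Λ` explicit — not a named fact), consumed by
`KaehlerIdentities.dolbeaultLaplacian_eq_delLaplacian`. Degrees are tracked by the index `j`
(`Λ j` acts on `(j+2)`-forms), never by subtraction. [cite: Voisin2002, Prop. 6.5] -/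
structure KaehlerIdentities
    (Λ : (j : ℕ) → MForm 𝓘(ℝ, E) M ℂ (j + 2) → MForm 𝓘(ℝ, E) M ℂ j) : Prop where
  /-- `Λ` is additive. -/
  map_add : ∀ (j : ℕ) (β γ : MForm 𝓘(ℝ, E) M ℂ (j + 2)), Λ j (β + γ) = Λ j β + Λ j γ
  /-- `Λ` maps smooth forms to smooth forms. -/
  isSmoothForm_map : ∀ (j : ℕ) {β : MForm 𝓘(ℝ, E) M ℂ (j + 2)},
    IsSmoothForm β → IsSmoothForm (Λ j β)
  /-- `[Λ, ∂̄] = -i∂*` on smooth forms of degree `j + 2 ≥ 2`. -/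
  comm_dolbeaultBar : ∀ {j m : ℕ} (h : (j + 1 + 1) + m = n) {β : MForm 𝓘(ℝ, E) M ℂ (j + 1 + 1)},
    IsSmoothForm β →
      Λ (j + 1) (dolbeaultBar β) - dolbeaultBar (Λ j β) = -(Complex.I • dolbeaultAdjoint o h β)
  /-- `[Λ, ∂̄] = -i∂*` on smooth `1`-forms (no term `∂̄Λβ`). -/
  comm_dolbeaultBar_one : ∀ {m : ℕ} (h : (0 + 1) + m = n) {β : MForm 𝓘(ℝ, E) M ℂ (0 + 1)},
    IsSmoothForm β → Λ 0 (dolbeaultBar β) = -(Complex.I • dolbeaultAdjoint o h β)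
  /-- `[Λ, ∂] = i∂̄*` on smooth forms of degree `j + 2 ≥ 2`. -/
  comm_dolbeault : ∀ {j m : ℕ} (h : (j + 1 + 1) + m = n) {β : MForm 𝓘(ℝ, E) M ℂ (j + 1 + 1)},
    IsSmoothForm β →
      Λ (j + 1) (dolbeault β) - dolbeault (Λ j β) = Complex.I • dolbeaultBarAdjoint o h β
  /-- `[Λ, ∂] = i∂̄*` on smooth `1`-forms (no term `∂Λβ`). -/
  comm_dolbeault_one : ∀ {m : ℕ} (h : (0 + 1) + m = n) {β : MForm 𝓘(ℝ, E) M ℂ (0 + 1)},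
    IsSmoothForm β → Λ 0 (dolbeault β) = Complex.I • dolbeaultBarAdjoint o h β

namespace KaehlerIdentities

variable {o} {Λ : (j : ℕ) → MForm 𝓘(ℝ, E) M ℂ (j + 2) → MForm 𝓘(ℝ, E) M ℂ j}
  (hΛ : KaehlerIdentities o Λ)
include hΛ

/-- An additive `Λ` kills `0`. [folklore] -/
theorem map_zero (j : ℕ) : Λ j 0 = 0 := by
  have h := hΛ.map_add j 0 0
  rw [add_zero] at h
  exact add_left_cancel (h.symm.trans (add_zero _).symm)

/-- An additive `Λ` commutes with negation. [folklore] -/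
theorem map_neg (j : ℕ) (β : MForm 𝓘(ℝ, E) M ℂ (j + 2)) : Λ j (-β) = -Λ j β := by
  have h := hΛ.map_add j β (-β)
  rw [add_neg_cancel, hΛ.map_zero] at h
  exact (neg_eq_of_add_eq_zero_right h.symm).symm

/-- An additive `Λ` commutes with subtraction. [folklore] -/
theorem map_sub (j : ℕ) (β γ : MForm 𝓘(ℝ, E) M ℂ (j + 2)) : Λ j (β - γ) = Λ j β - Λ j γ := by
  rw [sub_eq_add_neg, hΛ.map_add, hΛ.map_neg, ← sub_eq_add_neg]

/-- `∂* = i[Λ, ∂̄]` in degrees `≥ 2`: `∂*β = i(Λ∂̄β - ∂̄Λβ)` (Voisin (2002), proof of Thm. 6.7,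
"writing `∂* = i[Λ, ∂̄]`", p. 141). [cite: Voisin2002, Thm. 6.7] -/
theorem dolbeaultAdjoint_eq {j m : ℕ} (h : (j + 1 + 1) + m = n)
    {β : MForm 𝓘(ℝ, E) M ℂ (j + 1 + 1)} (hβ : IsSmoothForm β) :
    dolbeaultAdjoint o h β = Complex.I • (Λ (j + 1) (dolbeaultBar β) - dolbeaultBar (Λ j β)) := by
  rw [hΛ.comm_dolbeaultBar h hβ, smul_neg, smul_smul, Complex.I_mul_I, neg_smul, one_smul,
    neg_neg]

/-- `∂* = i[Λ, ∂̄]` on `1`-forms: `∂*β = iΛ∂̄β`. Voisin (2002), proof of Thm. 6.7. [cite: Voisin2002, Thm. 6.7] -/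
theorem dolbeaultAdjoint_eq_one {m : ℕ} (h : (0 + 1) + m = n)
    {β : MForm 𝓘(ℝ, E) M ℂ (0 + 1)} (hβ : IsSmoothForm β) :
    dolbeaultAdjoint o h β = Complex.I • Λ 0 (dolbeaultBar β) := by
  rw [hΛ.comm_dolbeaultBar_one h hβ, smul_neg, smul_smul, Complex.I_mul_I, neg_smul, one_smul,
    neg_neg]

/-- `∂̄* = -i[Λ, ∂]` in degrees `≥ 2`: `∂̄*β = -i(Λ∂β - ∂Λβ)` (Voisin (2002), proof of Thm. 6.7,
`∂̄* = ∂* - i[Λ, ∂]` … i.e. `-i[Λ, ∂]`, p. 141). [cite: Voisin2002, Thm. 6.7] -/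
theorem dolbeaultBarAdjoint_eq {j m : ℕ} (h : (j + 1 + 1) + m = n)
    {β : MForm 𝓘(ℝ, E) M ℂ (j + 1 + 1)} (hβ : IsSmoothForm β) :
    dolbeaultBarAdjoint o h β =
      -(Complex.I • (Λ (j + 1) (dolbeault β) - dolbeault (Λ j β))) := by
  rw [hΛ.comm_dolbeault h hβ, smul_smul, Complex.I_mul_I, neg_smul, one_smul, neg_neg]

/-- `∂̄* = -i[Λ, ∂]` on `1`-forms: `∂̄*β = -iΛ∂β`. Voisin (2002), proof of Thm. 6.7. [cite: Voisin2002, Thm. 6.7] -/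
theorem dolbeaultBarAdjoint_eq_one {m : ℕ} (h : (0 + 1) + m = n)
    {β : MForm 𝓘(ℝ, E) M ℂ (0 + 1)} (hβ : IsSmoothForm β) :
    dolbeaultBarAdjoint o h β = -(Complex.I • Λ 0 (dolbeault β)) := by
  rw [hΛ.comm_dolbeault_one h hβ, smul_smul, Complex.I_mul_I, neg_smul, one_smul, neg_neg]

/-- **Kähler identities ⇒ `Δ_∂̄ = Δ_∂`** (Huybrechts (2005), Prop. 3.1.12: proof of (iii) from
(ii), p. 122; Voisin (2002), Thm. 6.7, p. 141). On a complex manifold `M` with a metric on its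
real tangent bundle and an orientation family `o`, if a contraction family `Λ` satisfies the
first-order Kähler identities `KaehlerIdentities o Λ`, then the `∂̄`- and `∂`-Laplacians
`Δ_∂̄ = ∂̄∂̄* + ∂̄*∂̄`, `Δ_∂ = ∂∂* + ∂*∂` of `KaehlerHodge.lean` agree on every smooth complex
`k`-form, `k + m = n = dim_ℝ M`. The proof is Huybrechts' computation: substitute
`∂* = i[Λ, ∂̄]`, `∂̄* = -i[Λ, ∂]`; the difference of the two sides is
`i(Λ(∂∂̄ + ∂̄∂)α - (∂∂̄ + ∂̄∂)Λα) = 0` by `∂∂̄ = -∂̄∂`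
(`dolbeault_dolbeaultBar_add_dolbeaultBar_dolbeault_holds`) and additivity of `Λ`; the degenerate
degrees (functions, `1`-forms, top degree, where `∂α = ∂̄α = 0` by `cform_eq_zero_of_finrank_lt`)
are the corresponding truncations of the same computation. No Kähler, compactness or smoothness
hypothesis on the metric is needed at this stage: they enter only through the hypothesis
`KaehlerIdentities o Λ`. [cite: Huybrechts2005, Prop. 3.1.12 (iii)] -/
theorem dolbeaultLaplacian_eq_delLaplacian [IsManifold 𝓘(ℂ, E) ω M] [IsManifold 𝓘(ℝ, E) ∞ M]
    {k m : ℕ} (h : k + m = n) {α : MForm 𝓘(ℝ, E) M ℂ k} (hα : IsSmoothForm α) :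
    dolbeaultLaplacian o k m h α = delLaplacian o k m h α := by
  rcases k with - | k <;> rcases m with - | m
  · -- `n = 0`: both Laplacians are `0` by definition
    simp only [dolbeaultLaplacian, delLaplacian]
  · -- functions: `Δ_∂̄ f = ∂̄*∂̄f = -iΛ∂∂̄f = iΛ∂̄∂f = ∂*∂f = Δ_∂ f`
    simp only [dolbeaultLaplacian, delLaplacian]
    rw [hΛ.dolbeaultBarAdjoint_eq_one _ hα.dolbeaultBar, hΛ.dolbeaultAdjoint_eq_one _ hα.dolbeault,
      dolbeault_dolbeaultBar_eq_neg hα, hΛ.map_neg, smul_neg, neg_neg]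
  · -- top degree `k + 1 = n`: `∂α = ∂̄α = 0`
    simp only [dolbeaultLaplacian, delLaplacian]
    rcases k with - | j
    · rw [hΛ.dolbeaultBarAdjoint_eq_one _ hα, hΛ.dolbeaultAdjoint_eq_one _ hα,
        cform_eq_zero_of_finrank_lt (n := n) (by omega) (dolbeault α),
        cform_eq_zero_of_finrank_lt (n := n) (by omega) (dolbeaultBar α), hΛ.map_zero, smul_zero,
        neg_zero, dolbeaultBar_zero, dolbeault_zero]
    · have hΛα : IsSmoothForm (Λ j α) := hΛ.isSmoothForm_map j hα
      rw [hΛ.dolbeaultBarAdjoint_eq _ hα, hΛ.dolbeaultAdjoint_eq _ hα,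
        cform_eq_zero_of_finrank_lt (n := n) (by omega) (dolbeault α),
        cform_eq_zero_of_finrank_lt (n := n) (by omega) (dolbeaultBar α), hΛ.map_zero, zero_sub,
        zero_sub, smul_neg, neg_neg, smul_neg, dolbeaultBar_smul_holds Complex.I,
        dolbeault_neg, dolbeault_smul_holds Complex.I, dolbeault_dolbeaultBar_eq_neg hΛα,
        smul_neg, neg_neg]
  · -- generic degrees
    simp only [dolbeaultLaplacian, delLaplacian]
    rcases k with - | j
    · -- `1`-forms
      have hA : IsSmoothForm (Λ 0 (dolbeaultBar α)) := hΛ.isSmoothForm_map 0 hα.dolbeaultBar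
      have hA' : IsSmoothForm (Λ 0 (dolbeault α)) := hΛ.isSmoothForm_map 0 hα.dolbeault
      rw [hΛ.dolbeaultBarAdjoint_eq_one _ hα, hΛ.dolbeaultBarAdjoint_eq _ hα.dolbeaultBar,
        hΛ.dolbeaultAdjoint_eq_one _ hα, hΛ.dolbeaultAdjoint_eq _ hα.dolbeault,
        dolbeaultBar_neg, dolbeaultBar_smul_holds Complex.I, dolbeault_smul_holds Complex.I,
        dolbeault_dolbeaultBar_eq_neg hα, hΛ.map_neg]
      simp only [smul_sub, smul_neg]
      abel
    · -- degree `≥ 2`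
      have hΛα : IsSmoothForm (Λ j α) := hΛ.isSmoothForm_map j hα
      have hA : IsSmoothForm (Λ (j + 1) (dolbeaultBar α)) :=
        hΛ.isSmoothForm_map (j + 1) hα.dolbeaultBar
      have hA' : IsSmoothForm (Λ (j + 1) (dolbeault α)) :=
        hΛ.isSmoothForm_map (j + 1) hα.dolbeault
      rw [hΛ.dolbeaultBarAdjoint_eq _ hα, hΛ.dolbeaultBarAdjoint_eq _ hα.dolbeaultBar,
        hΛ.dolbeaultAdjoint_eq _ hα, hΛ.dolbeaultAdjoint_eq _ hα.dolbeault,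
        dolbeaultBar_neg, dolbeaultBar_smul_holds Complex.I, dolbeaultBar_sub hA' hΛα.dolbeault,
        dolbeault_smul_holds Complex.I, dolbeault_sub hA hΛα.dolbeaultBar,
        dolbeault_dolbeaultBar_eq_neg hα, hΛ.map_neg, dolbeault_dolbeaultBar_eq_neg hΛα]
      simp only [smul_sub, smul_neg, smul_add, sub_neg_eq_add]
      abel

end KaehlerIdentities

end Identities

/-! ### The named fact, from the Kähler identities -/

section NamedFact

variable [FiniteDimensional ℂ E] {n : ℕ} [Fact (finrank ℝ E = n)]
  [IsManifold 𝓘(ℂ, E) ω M] [IsManifold 𝓘(ℝ, E) ∞ M]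
  (g : ContMDiffRiemannianMetric 𝓘(ℝ, E) ∞ E (fun x : M ↦ TangentSpace 𝓘(ℝ, E) x))
  (o : (x : M) → Orientation ℝ (TangentSpace 𝓘(ℝ, E) x) (Fin n))

/-- **What remains of `Δ_∂̄ = Δ_∂`.** On a *complex* manifold `M` with a smooth metric `g` on
its real tangent bundle, the named fact
`Literature.NumberTheory.Transcendental.dolbeaultLaplacian_eq_delLaplacian g o` (Voisin (2002),
Thm. 6.7; Huybrechts (2005), Prop. 3.1.12 (iii)) in degrees `(k, m)` follows from the first-order
Kähler identities `KaehlerIdentities o Λ` for *some* contraction family `Λ` with respect to the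
metric `g` (Voisin (2002), Prop. 6.5, for the adjoint `Λ = ⋆⁻¹L⋆` of `L = ω ∧ ·` when `g` is
Kähler) — by `KaehlerIdentities.dolbeaultLaplacian_eq_delLaplacian`. The Kähler hypothesis and the
orientation hypothesis of the fact are not used at this stage (they are what a proof of
`KaehlerIdentities o Λ` consumes). The complex-manifold instances are genuine hypotheses here; the
named fact itself, as elaborated, quantifies over every real `C^∞` atlas.
[cite: Huybrechts2005, Prop. 3.1.12 (iii)] -/
theorem dolbeaultLaplacian_eq_delLaplacian_of_kaehlerIdentities {k m : ℕ}
    {Λ : (j : ℕ) → MForm 𝓘(ℝ, E) M ℂ (j + 2) → MForm 𝓘(ℝ, E) M ℂ j}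
    (hΛ : letI : RiemannianBundle (fun x : M ↦ TangentSpace 𝓘(ℝ, E) x) := ⟨g.toRiemannianMetric⟩
      KaehlerIdentities o Λ) :
    dolbeaultLaplacian_eq_delLaplacian (k := k) (m := m) g o := by
  intro _ h α hα
  letI : RiemannianBundle (fun x : M ↦ TangentSpace 𝓘(ℝ, E) x) := ⟨g.toRiemannianMetric⟩
  intro _
  exact hΛ.dolbeaultLaplacian_eq_delLaplacian h hα

end NamedFact

end Literature.NumberTheory.Transcendental
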